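import Summits.QuantumFields.YangMills.Theorems.BalabanLadderNTReferenceMargins
import HarnessLib

/-!
# Crux `NT` (stmt-QuantumFields-19353): the MARGINS of `RefPkgT` are β-UNIFORM NUMBERS, II — the three-point margin

Helper file (`--supports stmt-QuantumFields-19353`) of the fleet lead prover of crux `NT` (unit `ym-spine-19353-p1`,
g11), hypothesis-free; second of three (sequel of `…NTReferenceMargins`).  Clause 5 of the registered stub
`stub_refpkgT : RefPkgT` asks `ε + M₃(β) ≤ |Q3 G r β (L₀ β) (a β) f g h|` with
`M₃(β) = Σ_{x,y,z} |f(a x)||g(a y)||h(a z)| · (2(k w_zy + k w_zx + k w_yx + k³) + ω₃)`, `k = C₁(a/κ)⁴`,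
`w_pq = C₂(a/κ)⁴/(1 + ‖q − p‖)⁴`, `ω₃ = C₃(a/κ)⁴/(1 + min pairwise separation)⁸` (`a = a β`, sums over `box 4 (L₀ β)`).

* **`refMargin₃_le`** — for pairwise `δ`-separated witnesses with lattice ℓ¹-envelopes `K_f, K_g, K_h`, every unit
  `0 < a ≤ 1` and every finite `Λ ⊆ ℤ⁴`: **`M₃ ≤ K_f K_g K_h · (6 C₁C₂/(κ⁸δ⁴) + 2 C₁³/κ¹² + C₃/(κ⁴δ⁸))`** (the unit cancels
  exactly: `a¹²` from the three kernels and collars against `a⁻¹²` from the three envelopes);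
* `exists_sep_envelopes` (the data exist for every admissible triple: pairwise-disjoint supports in a ball have a common
  separation `δ > 0`, tree `exists_sep_of_disjoint_tsupport`), `exists_refMargin₃_le` (ONE number for all units `≤ 1`).

NUMBERS.  The clause-5 witness must clear `ε > K_fK_gK_h(6C₁C₂κ⁻⁸δ⁻⁴ + 2C₁³κ⁻¹² + C₃κ⁻⁴δ⁻⁸)`; against a physical
connected three-point function of order `g⁶/δ¹²` this is `κ/δ ≳ max((6C₁C₂)^{1/8} g^{-3/4}, (2C₁³)^{1/12} g^{-1/2},
C₃^{1/4} g^{-3/2})` — the three-point collar is the more demanding one (`g^{-3/2}` against `g^{-1}` for clause 4).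

HONEST FRAMING.  Elementary real analysis over tree objects; the floors and ceilings are engine-grade OPEN; not a floor,
not AF, not NT, not the seam, not the gap; not Clay.
-/

set_option autoImplicit false

noncomputable section

open scoped SchwartzMap
open MeasureTheory Filter Topology Finset
open Literature.MathematicalPhysics.QuantumFieldTheory Literature.MathematicalPhysics.QuantumLattice
open Literature.Probability.LatticeModels
open Summit.QuantumFields.YangMills.Cruxes.OSLegsFromFemtoAndGap.DlrCollarTransfer
open Summit.QuantumFields.YangMills.Cruxes.IR.AfOnset (exists_sum_abs_schwartz_lattice_le_div_min
  thetaTest_apply_eq_zero_of_tsupport_subset apply_eq_zero_of_tsupport_subset)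

namespace Summit.QuantumFields.YangMills.Cruxes.NT.Reference

/-! ## §3 The three-point margin is a β-uniform number -/

section Margin3

/-- **Clause-5 margin bound.**  Let `f, g, h` have pairwise separated supports with a common separation `δ > 0`
(`f p ≠ 0 → g q ≠ 0 → δ ≤ ‖p − q‖`, etc.) and lattice ℓ¹-envelopes `K_f, K_g, K_h` (`Σ_{x∈Λ}|f(a x)| ≤ K_f/a⁴` for
`0 < a ≤ 1`, …); let `C₁, C₂, C₃ ≥ 0`, `κ > 0`.  Then for every unit `0 < a ≤ 1` and every finite `Λ ⊆ ℤ⁴` the clause-5 margin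
of `RefPkgT` is at most `K_f K_g K_h (6C₁C₂/(κ⁸δ⁴) + 2C₁³/κ¹² + C₃/(κ⁴δ⁸))`. [folklore] -/
theorem refMargin₃_le {f g h : 𝓢(EuclideanSpace ℝ (Fin 4), ℝ)} {δ : ℝ} (hδ : 0 < δ)
    (hfg : ∀ p q : EuclideanSpace ℝ (Fin 4), f p ≠ 0 → g q ≠ 0 → δ ≤ ‖p - q‖)
    (hgh : ∀ p q : EuclideanSpace ℝ (Fin 4), g p ≠ 0 → h q ≠ 0 → δ ≤ ‖p - q‖)
    (hfh : ∀ p q : EuclideanSpace ℝ (Fin 4), f p ≠ 0 → h q ≠ 0 → δ ≤ ‖p - q‖)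
    {Kf Kg Kh : ℝ} (hKf0 : 0 ≤ Kf) (hKg0 : 0 ≤ Kg)
    (hKf : ∀ a : ℝ, 0 < a → a ≤ 1 → ∀ Λ : Finset (Fin 4 → ℤ), ∑ x ∈ Λ, |f (a • siteToE x)| ≤ Kf / a ^ 4)
    (hKg : ∀ a : ℝ, 0 < a → a ≤ 1 → ∀ Λ : Finset (Fin 4 → ℤ), ∑ y ∈ Λ, |g (a • siteToE y)| ≤ Kg / a ^ 4)
    (hKh : ∀ a : ℝ, 0 < a → a ≤ 1 → ∀ Λ : Finset (Fin 4 → ℤ), ∑ z ∈ Λ, |h (a • siteToE z)| ≤ Kh / a ^ 4)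
    {C₁ C₂ C₃ κ : ℝ} (hC₁ : 0 ≤ C₁) (hC₂ : 0 ≤ C₂) (hC₃ : 0 ≤ C₃) (hκ : 0 < κ) {a : ℝ} (ha : 0 < a) (ha1 : a ≤ 1)
    (Λ : Finset (Fin 4 → ℤ)) :
    ∑ x ∈ Λ, ∑ y ∈ Λ, ∑ z ∈ Λ,
        |f (a • siteToE x)| * |g (a • siteToE y)| * |h (a • siteToE z)| *
          (2 * ((C₁ * (a / κ) ^ 4) * (C₂ * (a / κ) ^ 4 / (1 + ‖siteToE (z - y)‖) ^ 4) +
                (C₁ * (a / κ) ^ 4) * (C₂ * (a / κ) ^ 4 / (1 + ‖siteToE (z - x)‖) ^ 4) +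
                (C₁ * (a / κ) ^ 4) * (C₂ * (a / κ) ^ 4 / (1 + ‖siteToE (y - x)‖) ^ 4) +
                (C₁ * (a / κ) ^ 4) * (C₁ * (a / κ) ^ 4) * (C₁ * (a / κ) ^ 4)) +
            C₃ * (a / κ) ^ 4 / (1 + min (min ‖siteToE (y - x)‖ ‖siteToE (z - y)‖) ‖siteToE (z - x)‖) ^ 8) ≤
      Kf * Kg * Kh * (6 * C₁ * C₂ / (κ ^ 8 * δ ^ 4) + 2 * C₁ ^ 3 / κ ^ 12 + C₃ / (κ ^ 4 * δ ^ 8)) := by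
  -- the per-triple bracket on charged triples is at most `B`
  set B : ℝ := 2 * (3 * ((C₁ * (a / κ) ^ 4) * (C₂ * (a / κ) ^ 4 * (a / δ) ^ 4)) +
      (C₁ * (a / κ) ^ 4) * (C₁ * (a / κ) ^ 4) * (C₁ * (a / κ) ^ 4)) + C₃ * (a / κ) ^ 4 * (a / δ) ^ 8 with hB
  have hk0 : 0 ≤ C₁ * (a / κ) ^ 4 := by positivity
  have hw0 : 0 ≤ C₂ * (a / κ) ^ 4 := by positivity
  have hB0 : 0 ≤ B := by positivity
  have hbr : ∀ x y z : Fin 4 → ℤ, f (a • siteToE x) ≠ 0 → g (a • siteToE y) ≠ 0 → h (a • siteToE z) ≠ 0 →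
      2 * ((C₁ * (a / κ) ^ 4) * (C₂ * (a / κ) ^ 4 / (1 + ‖siteToE (z - y)‖) ^ 4) +
            (C₁ * (a / κ) ^ 4) * (C₂ * (a / κ) ^ 4 / (1 + ‖siteToE (z - x)‖) ^ 4) +
            (C₁ * (a / κ) ^ 4) * (C₂ * (a / κ) ^ 4 / (1 + ‖siteToE (y - x)‖) ^ 4) +
            (C₁ * (a / κ) ^ 4) * (C₁ * (a / κ) ^ 4) * (C₁ * (a / κ) ^ 4)) +
          C₃ * (a / κ) ^ 4 / (1 + min (min ‖siteToE (y - x)‖ ‖siteToE (z - y)‖) ‖siteToE (z - x)‖) ^ 8 ≤ B := by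
    intro x y z hx hy hz
    have wle : ∀ t : ℝ, 1 / (1 + t) ^ 4 ≤ (a / δ) ^ 4 →
        C₂ * (a / κ) ^ 4 / (1 + t) ^ 4 ≤ C₂ * (a / κ) ^ 4 * (a / δ) ^ 4 := fun t ht => by
      rw [div_eq_mul_one_div]; exact mul_le_mul_of_nonneg_left ht hw0
    have h_zy := (inv_one_add_norm_pow_four_le_of_sep hδ hgh ha hy hz).1
    have h_zx := (inv_one_add_norm_pow_four_le_of_sep hδ hfh ha hx hz).1
    have h_yx := (inv_one_add_norm_pow_four_le_of_sep hδ hfg ha hx hy).1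
    have s_yx := (sep_le_mul_norm hfg ha hx hy).1
    have s_zy := (sep_le_mul_norm hgh ha hy hz).1
    have s_zx := (sep_le_mul_norm hfh ha hx hz).1
    have h_min := inv_one_add_min_pow_eight_le hδ ha (norm_nonneg _) (norm_nonneg _) (norm_nonneg _) s_yx s_zy s_zx
    have hω : C₃ * (a / κ) ^ 4 / (1 + min (min ‖siteToE (y - x)‖ ‖siteToE (z - y)‖) ‖siteToE (z - x)‖) ^ 8 ≤
        C₃ * (a / κ) ^ 4 * (a / δ) ^ 8 := by
      rw [div_eq_mul_one_div]; exact mul_le_mul_of_nonneg_left h_min (by positivity)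
    have t1 := mul_le_mul_of_nonneg_left (wle _ h_zy) hk0
    have t2 := mul_le_mul_of_nonneg_left (wle _ h_zx) hk0
    have t3 := mul_le_mul_of_nonneg_left (wle _ h_yx) hk0
    rw [hB]
    nlinarith [t1, t2, t3, hω]
  -- termwise comparison and factorisation
  have step1 : ∑ x ∈ Λ, ∑ y ∈ Λ, ∑ z ∈ Λ,
        |f (a • siteToE x)| * |g (a • siteToE y)| * |h (a • siteToE z)| *
          (2 * ((C₁ * (a / κ) ^ 4) * (C₂ * (a / κ) ^ 4 / (1 + ‖siteToE (z - y)‖) ^ 4) +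
                (C₁ * (a / κ) ^ 4) * (C₂ * (a / κ) ^ 4 / (1 + ‖siteToE (z - x)‖) ^ 4) +
                (C₁ * (a / κ) ^ 4) * (C₂ * (a / κ) ^ 4 / (1 + ‖siteToE (y - x)‖) ^ 4) +
                (C₁ * (a / κ) ^ 4) * (C₁ * (a / κ) ^ 4) * (C₁ * (a / κ) ^ 4)) +
            C₃ * (a / κ) ^ 4 / (1 + min (min ‖siteToE (y - x)‖ ‖siteToE (z - y)‖) ‖siteToE (z - x)‖) ^ 8) ≤
      ∑ x ∈ Λ, ∑ y ∈ Λ, ∑ z ∈ Λ, |f (a • siteToE x)| * |g (a • siteToE y)| * |h (a • siteToE z)| * B := by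
    refine sum_le_sum fun x _ => sum_le_sum fun y _ => sum_le_sum fun z _ => ?_
    by_cases hx : f (a • siteToE x) = 0
    · simp [hx]
    by_cases hy : g (a • siteToE y) = 0
    · simp [hy]
    by_cases hz : h (a • siteToE z) = 0
    · simp [hz]
    exact mul_le_mul_of_nonneg_left (hbr x y z hx hy hz) (by positivity)
  have step2 : ∑ x ∈ Λ, ∑ y ∈ Λ, ∑ z ∈ Λ, |f (a • siteToE x)| * |g (a • siteToE y)| * |h (a • siteToE z)| * B =
      (∑ x ∈ Λ, |f (a • siteToE x)|) * (∑ y ∈ Λ, |g (a • siteToE y)|) * (∑ z ∈ Λ, |h (a • siteToE z)|) * B := by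
    rw [sum_mul_sum, sum_mul, sum_mul]
    refine sum_congr rfl fun x _ => ?_
    rw [sum_mul, sum_mul]
    refine sum_congr rfl fun y _ => ?_
    rw [mul_sum, sum_mul]
  rw [step2] at step1
  refine step1.trans ?_
  -- envelopes
  have ha4 : 0 < a ^ 4 := pow_pos ha 4
  set Sf := ∑ x ∈ Λ, |f (a • siteToE x)|
  set Sg := ∑ y ∈ Λ, |g (a • siteToE y)|
  set Sh := ∑ z ∈ Λ, |h (a • siteToE z)|
  have hSf0 : 0 ≤ Sf := sum_nonneg fun _ _ => abs_nonneg _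
  have hSg0 : 0 ≤ Sg := sum_nonneg fun _ _ => abs_nonneg _
  have hSh0 : 0 ≤ Sh := sum_nonneg fun _ _ => abs_nonneg _
  have hKh0 : 0 ≤ Kh := by
    have := hSh0.trans (hKh a ha ha1 Λ)
    rwa [le_div_iff₀ ha4, zero_mul] at this
  have hprod : Sf * Sg * Sh ≤ Kf / a ^ 4 * (Kg / a ^ 4) * (Kh / a ^ 4) :=
    mul_le_mul (mul_le_mul (hKf a ha ha1 Λ) (hKg a ha ha1 Λ) hSg0 (div_nonneg hKf0 ha4.le)) (hKh a ha ha1 Λ) hSh0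
      (mul_nonneg (div_nonneg hKf0 ha4.le) (div_nonneg hKg0 ha4.le))
  have e : Kf * Kg * Kh * (6 * C₁ * C₂ / (κ ^ 8 * δ ^ 4) + 2 * C₁ ^ 3 / κ ^ 12 + C₃ / (κ ^ 4 * δ ^ 8)) =
      Kf / a ^ 4 * (Kg / a ^ 4) * (Kh / a ^ 4) * B := by
    rw [hB]; field_simp; ring
  rw [e]
  exact mul_le_mul_of_nonneg_right hprod hB0

/-- **The data exist for every admissible clause-5 witness triple**: pairwise-disjoint supports inside a ball have a common
positive separation, and every test function has lattice ℓ¹-envelopes. [folklore] -/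
theorem exists_sep_envelopes {f g h : 𝓢(EuclideanSpace ℝ (Fin 4), ℝ)} {σ : ℝ}
    (hfg : Disjoint (tsupport (f : EuclideanSpace ℝ (Fin 4) → ℝ)) (tsupport (g : EuclideanSpace ℝ (Fin 4) → ℝ)))
    (hgh : Disjoint (tsupport (g : EuclideanSpace ℝ (Fin 4) → ℝ)) (tsupport (h : EuclideanSpace ℝ (Fin 4) → ℝ)))
    (hfh : Disjoint (tsupport (f : EuclideanSpace ℝ (Fin 4) → ℝ)) (tsupport (h : EuclideanSpace ℝ (Fin 4) → ℝ)))
    (hfσ : tsupport (f : EuclideanSpace ℝ (Fin 4) → ℝ) ⊆ Metric.closedBall 0 σ)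
    (hgσ : tsupport (g : EuclideanSpace ℝ (Fin 4) → ℝ) ⊆ Metric.closedBall 0 σ) :
    ∃ δ Kf Kg Kh : ℝ, 0 < δ ∧
      (∀ p q : EuclideanSpace ℝ (Fin 4), f p ≠ 0 → g q ≠ 0 → δ ≤ ‖p - q‖) ∧
      (∀ p q : EuclideanSpace ℝ (Fin 4), g p ≠ 0 → h q ≠ 0 → δ ≤ ‖p - q‖) ∧
      (∀ p q : EuclideanSpace ℝ (Fin 4), f p ≠ 0 → h q ≠ 0 → δ ≤ ‖p - q‖) ∧ 0 ≤ Kf ∧ 0 ≤ Kg ∧ 0 ≤ Kh ∧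
      (∀ a : ℝ, 0 < a → a ≤ 1 → ∀ Λ : Finset (Fin 4 → ℤ), ∑ x ∈ Λ, |f (a • siteToE x)| ≤ Kf / a ^ 4) ∧
      (∀ a : ℝ, 0 < a → a ≤ 1 → ∀ Λ : Finset (Fin 4 → ℤ), ∑ y ∈ Λ, |g (a • siteToE y)| ≤ Kg / a ^ 4) ∧
      (∀ a : ℝ, 0 < a → a ≤ 1 → ∀ Λ : Finset (Fin 4 → ℤ), ∑ z ∈ Λ, |h (a • siteToE z)| ≤ Kh / a ^ 4) := by
  obtain ⟨δ₁, hδ₁, h₁⟩ := exists_sep_of_disjoint_tsupport hfg hfσ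
  obtain ⟨δ₂, hδ₂, h₂⟩ := exists_sep_of_disjoint_tsupport hgh hgσ
  obtain ⟨δ₃, hδ₃, h₃⟩ := exists_sep_of_disjoint_tsupport hfh hfσ
  obtain ⟨Kf, hKf0, hKf⟩ := exists_sum_abs_schwartz_lattice_le_div_min f
  obtain ⟨Kg, hKg0, hKg⟩ := exists_sum_abs_schwartz_lattice_le_div_min g
  obtain ⟨Kh, hKh0, hKh⟩ := exists_sum_abs_schwartz_lattice_le_div_min h
  refine ⟨min (min δ₁ δ₂) δ₃, Kf, Kg, Kh, lt_min (lt_min hδ₁ hδ₂) hδ₃,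
    fun p q hp hq => (min_le_left _ _).trans ((min_le_left _ _).trans (h₁ p q hp hq)),
    fun p q hp hq => (min_le_left _ _).trans ((min_le_right _ _).trans (h₂ p q hp hq)),
    fun p q hp hq => (min_le_right _ _).trans (h₃ p q hp hq), hKf0, hKg0, hKh0,
    fun a ha ha1 Λ => ?_, fun a ha ha1 Λ => ?_, fun a ha ha1 Λ => ?_⟩
  · have hh := hKf a ha Λ; rwa [min_eq_left ha1] at hh
  · have hh := hKg a ha Λ; rwa [min_eq_left ha1] at hh
  · have hh := hKh a ha Λ; rwa [min_eq_left ha1] at hh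

/-- **Existential form**: for every admissible clause-5 witness triple and constants there is ONE number `M ≥ 0` bounding
the clause-5 margin at every unit `0 < a ≤ 1` and every finite box. [folklore] -/
theorem exists_refMargin₃_le {f g h : 𝓢(EuclideanSpace ℝ (Fin 4), ℝ)} {σ : ℝ}
    (hfg : Disjoint (tsupport (f : EuclideanSpace ℝ (Fin 4) → ℝ)) (tsupport (g : EuclideanSpace ℝ (Fin 4) → ℝ)))
    (hgh : Disjoint (tsupport (g : EuclideanSpace ℝ (Fin 4) → ℝ)) (tsupport (h : EuclideanSpace ℝ (Fin 4) → ℝ)))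
    (hfh : Disjoint (tsupport (f : EuclideanSpace ℝ (Fin 4) → ℝ)) (tsupport (h : EuclideanSpace ℝ (Fin 4) → ℝ)))
    (hfσ : tsupport (f : EuclideanSpace ℝ (Fin 4) → ℝ) ⊆ Metric.closedBall 0 σ)
    (hgσ : tsupport (g : EuclideanSpace ℝ (Fin 4) → ℝ) ⊆ Metric.closedBall 0 σ)
    {C₁ C₂ C₃ κ : ℝ} (hC₁ : 0 ≤ C₁) (hC₂ : 0 ≤ C₂) (hC₃ : 0 ≤ C₃) (hκ : 0 < κ) :
    ∃ M : ℝ, 0 ≤ M ∧ ∀ a : ℝ, 0 < a → a ≤ 1 → ∀ Λ : Finset (Fin 4 → ℤ),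
      ∑ x ∈ Λ, ∑ y ∈ Λ, ∑ z ∈ Λ,
          |f (a • siteToE x)| * |g (a • siteToE y)| * |h (a • siteToE z)| *
            (2 * ((C₁ * (a / κ) ^ 4) * (C₂ * (a / κ) ^ 4 / (1 + ‖siteToE (z - y)‖) ^ 4) +
                  (C₁ * (a / κ) ^ 4) * (C₂ * (a / κ) ^ 4 / (1 + ‖siteToE (z - x)‖) ^ 4) +
                  (C₁ * (a / κ) ^ 4) * (C₂ * (a / κ) ^ 4 / (1 + ‖siteToE (y - x)‖) ^ 4) +
                  (C₁ * (a / κ) ^ 4) * (C₁ * (a / κ) ^ 4) * (C₁ * (a / κ) ^ 4)) +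
              C₃ * (a / κ) ^ 4 / (1 + min (min ‖siteToE (y - x)‖ ‖siteToE (z - y)‖) ‖siteToE (z - x)‖) ^ 8) ≤ M := by
  obtain ⟨δ, Kf, Kg, Kh, hδ, h₁, h₂, h₃, hKf0, hKg0, hKh0, hKf, hKg, hKh⟩ := exists_sep_envelopes hfg hgh hfh hfσ hgσ
  exact ⟨Kf * Kg * Kh * (6 * C₁ * C₂ / (κ ^ 8 * δ ^ 4) + 2 * C₁ ^ 3 / κ ^ 12 + C₃ / (κ ^ 4 * δ ^ 8)), by positivity,
    fun a ha ha1 Λ => refMargin₃_le hδ h₁ h₂ h₃ hKf0 hKg0 hKf hKg hKh hC₁ hC₂ hC₃ hκ ha ha1 Λ⟩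

end Margin3

end Summit.QuantumFields.YangMills.Cruxes.NT.Reference

end
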